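/- Copyright: the b2b-balaban cell (near-miss cell 7), T⁴-continuum fan-out, lineage t4-ne7b-formalise-leaf-02 (NE7b
CRUX team (2), leaf prover 02), gen 108 — CANDIDATE BYTES for the announced INTERFACE REQUEST NE7b IR-99-3 of the
row-NE7b OWNER `t4-ne7b-p1` (journal l.47115: «J2b = the tower's own SHIFTED `HistReading` + `w :=` the shifted
stencil ⇒ `histRead_tower_of_hw`», owner or leaf-02, after J1 + J2a land): (α)-instance, (A3) module J2b — THE
CAUSAL READING of the tower instance, the per-history display of J1 ELIMINATED.  Released under the licence of the
surrounding project. -/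
import Summits.QuantumFields.BalabanUV.T4Continuum.Support.B16HistoryReprRead
import Summits.QuantumFields.BalabanUV.T4Continuum.Support.HistoryGenealogyInstantiateMCausal

/-!
# (α)-INSTANCE, (A3) module J2b (tower instance): THE CAUSAL READING — `HistRead` for the tower from the per-step
unit-weight display ALONE (announced INTERFACE REQUEST NE7b IR-99-3)

Summits-side support sketch of the T⁴-continuum cell (rung (B)+1 on a FINITE torus only; NOT infinite volume, NOT the
mass gap, NOT Clay; NOT a proof of NE7b — the cell's OWN estimate, NOT PRINTED, NOT PROVED).  [folklore] finite-sum
algebra and finite combinatorics over J1 (`B16HistoryReprRead`: `factorsOf`, `histRead_tower_shifted`), IR-97-2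
parts 1–2 (`Tower`, `skelFam`, `reprFam`, `hsmall`), M2-B (`HistReading`, `HistFactors.levelFactor`, `HistRead`,
`weight_le_evProd`), leaf-05's process (`RunInputM`, `histM`, `rnwM`) and J2a = IR-99-2
(`HistoryGenealogyInstantiateMCausal`: `histM_comp_congr`, `histM_constit_congr`, `parts_histM_zero`, `rnwM_congr`);
nothing printed is asserted, no `def … : Prop` fact of Bałaban's, no cite-tagged hypothesis, zero `sorry`.
[Balaban1989LargeFieldII] (1.79) p. 383 and p. 384 l. 4–6 are quoted as LOCATORS only.

WHY.  J1's finest forms (`histRead_tower_stencil` ∕ `histRead_tower_shifted`) still DISPLAY, per admissible history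
`h` and step `j`, that the step-`j` envelope `w K j (h|_j) (h j)` is at most a product of level factors of the
components of the process run on the input READ OFF THE WHOLE HISTORY `h` — a per-history display whose right side
mentions the future of the step.  HERE the reading is built from PER-STEP data and the display disappears: a
**`StepReading`** `𝒮` says which new large-field regions `𝒮.ν K j g p` (booked at the level `j + 1` the step forms)
and which new-field cubes `𝒮.φ K j g p` (consumed by the level-`j` 𝐑-operation) the choice `p` after the prefix `g`
names, with the flow `L`, `s K`, `R K`, `Rm K` of the run and classes `𝒮.κ K`; **`runPartial K m g`** is the input of
print's process read off a PARTIAL history `g : Fin m → P` (nothing at level `0`, nothing above the prefix);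
**`reading T p₀`** is the `HistReading` over `skelFam T p₀` it induces (`runOf K a ι = runPartial K K ι.1`
definitionally); and THE PER-STEP ENVELOPE IS DEFINED, not displayed: **`wStep K j g p`** := the product, over the
components of level `j + 1` of the process read off the prefix `snoc g p`, of their level factors (volume
`Λ K (j+1) ^ #domain` × renewal factors of the renewed parts × birth factors of the new regions — print's three
kinds, (1.79)).  By J2a (the process is CAUSAL) the level-`(j+1)` components and level factors of the run read
off the whole history ARE those of the run read off its prefix of length `j + 1` (**`wStep_take`**), so J1's `hshift`
holds WITH EQUALITY and **`histRead_tower_of_hw`** proves `HistRead (𝒮.reading T p₀) (factorsOf … (𝒮.wStep …))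
(reprFam …) l₀ K₀` from: (i) **`hw`** — U1 PER STEP IN LEVEL-FACTOR FORM: the unit weight of the tower's step-`j`
operation after `g` with choice `p` is at most `𝒮.wStep K j g p` (this IS (1.79) p. 383 read per operation, with
p. 384 l. 4–6's factorisation over the components the step forms — the one display left, (A1)∕(A1c)'s to discharge
for Bałaban's tower); (ii) `hBρ` — the sup of the dressed initial density; (iii) `hν0` — the small-field choice names
no region; and non-negative factor values.  **`newOK_run`**: M2-B's per-term binder `NewOK` for every run of the
reading follows from the displayed geometric condition `hν` on the regions a step names (anchor inside,
face-connected, class ≥ tree length); **`weight_le_evProd_of_hw`**: M2-B's weight bound for every tower term, BY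
NAME, from (i)–(iii), `hν` and the flow condition `Rm ≤ R`.

NOT HERE (honest).  Which regions ∕ cubes Bałaban's choice names (the CONTENT of `𝒮` — (A1c)); the per-operation
bound (i) for Bałaban's 𝐑𝐓-step ((A1)'s (1.79) as a named fact + (A1c)'s identification of the tower); the class of
a region is read off its label per run (`κ K`, a geometric datum such as its size class — a history-dependent class
map is a routine generalisation by first-birth-step lookup, causal by the same lemma); M5; any estimate.  BY-NAME
EFFECT ON THE WALL (`WALL-NE7b-P1.md` §2): NONE — `hR : HistRead` becomes a theorem for a tower-form run with a
step reading GIVEN (i), the per-OPERATION display of print's kind; R2's per-history ∕ per-term form is gone.  HONEST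
DEPENDENCY (cell): continuum YM on T⁴ ⇐ BetaPertH ∧ nine spine estimates (0/9 proved); BetaPertH ⇐ (D1) ∧ (D4) ∧
CAP+tail; G-an2-4 gates asym, D1 and NE2/3/4.  This file changes none of it.
-/

open Finset MeasureTheory
open Literature.MathematicalPhysics.QuantumFieldTheory.Balaban1983to89
open Literature.MathematicalPhysics.QuantumFieldTheory.Balaban1983to89.B13ScaleTransfer
open Literature.MathematicalPhysics.QuantumFieldTheory.Balaban1983to89.TreeLength
open Literature.MathematicalPhysics.QuantumFieldTheory.Balaban1983to89.B16MergeGeometry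
open Summit.QuantumFields.BalabanUV.T4Continuum.HistoryAdmissible
open Summit.QuantumFields.BalabanUV.T4Continuum.HistoryGen
open Summit.QuantumFields.BalabanUV.T4Continuum.HistoryGenealogyExtraction
open Summit.QuantumFields.BalabanUV.T4Continuum.HistoryGenealogyRealise
open Summit.QuantumFields.BalabanUV.T4Continuum.HistoryGenealogyInstantiate
open Summit.QuantumFields.BalabanUV.T4Continuum.HistoryGenealogyPedigree
open Summit.QuantumFields.BalabanUV.T4Continuum.HistoryRealiseWeakCells
open Summit.QuantumFields.BalabanUV.T4Continuum.HistoryTouchComponents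

namespace Summit.QuantumFields.BalabanUV.T4Continuum.B16HistoryReprReadCausal

open Summit.QuantumFields.BalabanUV.T4Continuum.B16HistoryIndexedRepr
open Summit.QuantumFields.BalabanUV.T4Continuum.B16HistoryReprChain
open Summit.QuantumFields.BalabanUV.T4Continuum.B16HistoryReprInstance
open Summit.QuantumFields.BalabanUV.T4Continuum.B16HistoryReprRead

noncomputable section

/-! ## §1 The level factor from the factor VALUES (so that the per-step envelope can be defined before `factorsOf`) -/

section LevelFactorValues

variable {d : ℕ} (fB : ℕ → ℕ → ℕ → Lab d → ℝ) (fR : ℕ → ℕ → ℝ) (Λ : ℕ → ℕ → ℝ)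

/-- **THE LEVEL FACTOR OF A COMPONENT FROM THE FACTOR VALUES** `fB fR Λ`: volume `Λ K j ^ #c.2` × renewal factors of
the renewed parts × birth factors of the new regions — M2-B's `HistFactors.levelFactor` with the values unbundled
(`levelFactor_factorsOf`). [folklore] -/
def lf (H : ComponentHistory (Lab d)) (rnw : ℕ → Lab d → Bool) (K j : ℕ) (c : Lab d) : ℝ :=
  Λ K j ^ (c.2).card * (H.rfacs rnw (fR K) j c * ((H.news j c).map fun n => fB K j (H.cls n) n).prod)

/-- the level factor from non-negative values is non-negative [folklore] -/
theorem lf_nonneg (hfB : ∀ K j d' n, 0 ≤ fB K j d' n) (hfR : ∀ K h, 0 ≤ fR K h) (hΛ : ∀ K j, 1 ≤ Λ K j)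
    (H : ComponentHistory (Lab d)) (rnw : ℕ → Lab d → Bool) (K j : ℕ) (c : Lab d) :
    0 ≤ lf fB fR Λ H rnw K j c := by
  unfold lf ComponentHistory.rfacs
  refine mul_nonneg (pow_nonneg (zero_le_one.trans (hΛ K j)) _)
    (mul_nonneg (List.prod_nonneg fun x hx => ?_) (List.prod_nonneg fun x hx => ?_))
  · obtain ⟨p, -, rfl⟩ := List.mem_map.mp hx
    split_ifs
    · exact hfR K _
    · exact zero_le_one
  · obtain ⟨n, -, rfl⟩ := List.mem_map.mp hx
    exact hfB K j _ n

/-- the classes of the extracted bookkeeping are the input's [folklore] -/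
theorem histM_cls (J : RunInputM d) : J.histM.cls = J.cls := rfl

/-- **THE LEVEL FACTORS ARE CAUSAL** (J2a): two inputs with the same flow and classes, the same new regions at the
levels `≤ ℓ` and the same new fields at the levels `< ℓ` have the same level-`ℓ` factors — `parts`∕`news` by
`histM_constit_congr`, the renewal flags of the parts by `rnwM_congr` at level `ℓ − 1` (level `0`: `parts_histM_zero`,
no part to renew); junction onto IR-99-2's landed names located by leaf-06 g135 (L-leaf06-g135-1, W-ne7bp1-g99-3 A2).
[folklore] -/
theorem lf_congr {J J' : RunInputM d} (hL : J.L = J'.L) (hs : J.s = J'.s) (hRm : J.Rm = J'.Rm)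
    (hcls : J.cls = J'.cls) {ℓ : ℕ} (hN : ∀ m ≤ ℓ, J.N m = J'.N m) (hF : ∀ m < ℓ, J.F m = J'.F m)
    (K : ℕ) (c : Lab d) :
    lf fB fR Λ J.histM J.rnwM K ℓ c = lf fB fR Λ J'.histM J'.rnwM K ℓ c := by
  have hcon := congrFun (RunInputM.histM_constit_congr hL hs hRm hN hF) c
  have hparts : J.histM.parts ℓ c = J'.histM.parts ℓ c := by
    unfold ComponentHistory.parts; rw [hcon]
  have hnews : J.histM.news ℓ c = J'.histM.news ℓ c := by
    unfold ComponentHistory.news; rw [hcon]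
  have hrnw : ∀ p ∈ J.histM.parts ℓ c, J.rnwM (ℓ - 1) p = J'.rnwM (ℓ - 1) p := by
    cases ℓ with
    | zero =>
        intro p hp
        rw [RunInputM.parts_histM_zero] at hp
        exact absurd hp List.not_mem_nil
    | succ ℓ =>
        intro p _
        rw [Nat.add_sub_cancel]
        exact congrFun (RunInputM.rnwM_congr hL hs hRm (fun m hm => hN m (Nat.le_succ_of_le hm))
          (fun m hm => hF m (Nat.lt_succ_of_le hm))) p
  unfold lf ComponentHistory.rfacs
  rw [← hnews, ← hparts, histM_cls, histM_cls]
  congr 2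
  · exact congrArg List.prod (List.map_congr_left fun p hp => by rw [hrnw p hp])
  · exact congrArg List.prod (List.map_congr_left fun n _ => by rw [hcls])

end LevelFactorValues

section LevelFactorBundled

variable {d : ℕ} {DomK : ℕ → Type} {I₀ : (K : ℕ) → HIndex (DomK K)} (Φf : HistFactors I₀ d)

/-- M2-B's level factor of ANY factor bundle IS `lf` of its values (definitionally) [folklore] -/
theorem levelFactor_eq_lf (H : ComponentHistory (Lab d)) (rnw : ℕ → Lab d → Bool) (K j : ℕ) (c : Lab d) :
    Φf.levelFactor H rnw K j c = lf Φf.fB Φf.fR Φf.Λ H rnw K j c := rfl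

/-- **THE CONSUMER FORM OF CAUSALITY (IR-99-2's `levelFactor_histM_congr`)**: two inputs with the same flow and classes,
the same regions at the levels `≤ m` and the same new fields at the levels `ℓ − 1`, `ℓ ≤ m`, have the same M2-B level
factors at every level `ℓ ≤ m`, for any factor bundle `Φf`. [folklore] -/
theorem levelFactor_histM_congr {J J' : RunInputM d} (hL : J.L = J'.L) (hs : J.s = J'.s) (hRm : J.Rm = J'.Rm)
    (hcls : J.cls = J'.cls) {ℓ : ℕ} (hN : ∀ m ≤ ℓ, J.N m = J'.N m) (hF : ∀ m < ℓ, J.F m = J'.F m)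
    (K : ℕ) (c : Lab d) :
    Φf.levelFactor J.histM J.rnwM K ℓ c = Φf.levelFactor J'.histM J'.rnwM K ℓ c :=
  lf_congr Φf.fB Φf.fR Φf.Λ hL hs hRm hcls hN hF K c

end LevelFactorBundled

/-! ## §2 The step reading, the run read off a partial history, the induced `HistReading`, the per-step envelope -/

/-- **A STEP READING** of a tower's choices: the flow of the run with cutoff `K` (blocking `L`, exponents `s K`,
sizes `R K`, readiness memory `Rm K`), the classes `κ K` of regions, and, PER STEP, the new large-field regions
`ν K j g p` and the new-field cubes `φ K j g p` the choice `p` after the prefix `g : Fin j → P` names.  Pure data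
(WHICH regions Bałaban's choice names is (A1c)'s); nothing asserted. [folklore] -/
structure StepReading (P : Type) (d : ℕ) where
  /-- blocking parameter -/
  L : ℕ
  /-- size exponents of the run with cutoff `K` -/
  s : ℕ → ℕ → ℕ
  /-- sizes `R_j` of the run with cutoff `K` -/
  R : ℕ → ℕ → ℕ
  /-- readiness memory of the run with cutoff `K` -/
  Rm : ℕ → ℕ → ℕ → ℕ
  /-- classes of regions, per run -/
  κ : ℕ → Lab d → ℕ
  /-- new large-field regions named by the choice `p` after the prefix `g` at step `j` of run `K` -/
  ν : (K j : ℕ) → (Fin j → P) → P → Finset (Lab d)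
  /-- new-field cubes named by the choice `p` after the prefix `g` at step `j` of run `K` -/
  φ : (K j : ℕ) → (Fin j → P) → P → Finset (Pt d)

namespace StepReading

variable {P : Type} {d : ℕ} (𝒮 : StepReading P d)

/-- the regions a partial history `g : Fin m → P` books, per level: none at level `0`; at level `ℓ + 1` those the
step `ℓ < m` names; none above the prefix [folklore] -/
def Nof (K m : ℕ) (g : Fin m → P) : ℕ → Finset (Lab d)
  | 0 => ∅
  | ℓ + 1 => if h : ℓ < m then 𝒮.ν K ℓ (Fin.take ℓ h.le g) (g ⟨ℓ, h⟩) else ∅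

/-- the new-field cubes a partial history books at level `ℓ`: those the step `ℓ < m` names [folklore] -/
def Fof (K m : ℕ) (g : Fin m → P) (ℓ : ℕ) : Finset (Pt d) :=
  if h : ℓ < m then 𝒮.φ K ℓ (Fin.take ℓ h.le g) (g ⟨ℓ, h⟩) else ∅

/-- **THE RUN READ OFF A PARTIAL HISTORY** (input of print's memory-generic process). [folklore] -/
def runPartial (K m : ℕ) (g : Fin m → P) : RunInputM d :=
  { L := 𝒮.L, s := 𝒮.s K, R := 𝒮.R K, N := 𝒮.Nof K m g, cls := 𝒮.κ K, F := 𝒮.Fof K m g, Rm := 𝒮.Rm K }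

/-- nothing is booked at level `0` [folklore] -/
@[simp] theorem Nof_zero (K m : ℕ) (g : Fin m → P) : 𝒮.Nof K m g 0 = ∅ := rfl

/-- the regions of level `ℓ + 1 ≤ m` booked by a prefix of a history are those booked by the history [folklore] -/
theorem Nof_take_succ {K n m : ℕ} (hm : m ≤ n) (h : Fin n → P) {ℓ : ℕ} (hℓ : ℓ < m) :
    𝒮.Nof K m (Fin.take m hm h) (ℓ + 1) = 𝒮.Nof K n h (ℓ + 1) := by
  simp only [Nof, dif_pos hℓ, dif_pos (Nat.lt_of_lt_of_le hℓ hm), Fin.take_take, Fin.take_apply]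
  rfl

/-- the new fields of level `ℓ < m` booked by a prefix of a history are those booked by the history [folklore] -/
theorem Fof_take {K n m : ℕ} (hm : m ≤ n) (h : Fin n → P) {ℓ : ℕ} (hℓ : ℓ < m) :
    𝒮.Fof K m (Fin.take m hm h) ℓ = 𝒮.Fof K n h ℓ := by
  simp only [Fof, dif_pos hℓ, dif_pos (Nat.lt_of_lt_of_le hℓ hm), Fin.take_take, Fin.take_apply]
  rfl

/-- a history whose every choice names no region books no region [folklore] -/
theorem Nof_eq_empty {K m : ℕ} {g : Fin m → P} (hg : ∀ j : Fin m, 𝒮.ν K j (Fin.take j j.2.le g) (g j) = ∅) :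
    ∀ ℓ, 𝒮.Nof K m g ℓ = ∅
  | 0 => rfl
  | ℓ + 1 => by
      by_cases h : ℓ < m
      · rw [Nof, dif_pos h]
        exact hg ⟨ℓ, h⟩
      · rw [Nof, dif_neg h]

/-- **`NewOK` FOR EVERY RUN READ OFF A HISTORY** from the displayed geometric condition on the regions a step names
(anchor inside, face-connected, class at least the tree length). [folklore] -/
theorem newOK_runPartial
    (hν : ∀ K j g p, ∀ n ∈ 𝒮.ν K j g p, n.1 ∈ n.2 ∧ FaceConnected n.2 ∧ treeLen n.2 ≤ 𝒮.κ K n)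
    (K m : ℕ) (g : Fin m → P) : (𝒮.runPartial K m g).NewOK := by
  refine ⟨fun ℓ n hn => ?_⟩
  cases ℓ with
  | zero => exact absurd hn (Finset.notMem_empty n)
  | succ ℓ =>
      change n ∈ 𝒮.Nof K m g (ℓ + 1) at hn
      by_cases h : ℓ < m
      · rw [Nof, dif_pos h] at hn
        exact hν K ℓ _ _ n hn
      · rw [Nof, dif_neg h] at hn
        exact absurd hn (Finset.notMem_empty n)

section Reading

variable {C : ℕ → ℕ → Type} {𝒢 : (K j : ℕ) → GoodClass (C K j)} (T : (K : ℕ) → Tower P (C K) (𝒢 K))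
  (p₀ : ℕ → ℕ → P) [DecidableEq P]

/-- **THE `HistReading` INDUCED ON THE TOWER's SKELETON FAMILY**: the history choice `(h, (), ())` of either summand
at cutoff `K` reads the run off the whole history `h`. [folklore] -/
def reading : HistReading (skelFam T p₀) d where
  L := 𝒮.L
  s := 𝒮.s
  R := 𝒮.R
  Rm := 𝒮.Rm
  N K _ ι := 𝒮.Nof K K ι.1
  cls K _ _ := 𝒮.κ K
  F K _ ι := 𝒮.Fof K K ι.1

/-- the run the reading assigns to a history choice IS the run read off the history (definitionally) [folklore] -/
theorem runOf_reading (K : ℕ) (a : (skelFam T p₀ K).Adm) (ι : (Fin K → P) × Unit × Unit) :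
    (𝒮.reading T p₀).runOf K a ι = 𝒮.runPartial K K ι.1 := rfl

/-- `NewOK` for every run of the induced input family (M2-B's per-term binder `hN`, discharged from `hν`).
[folklore] -/
theorem newOK_run (hν : ∀ K j g p, ∀ n ∈ 𝒮.ν K j g p, n.1 ∈ n.2 ∧ FaceConnected n.2 ∧ treeLen n.2 ≤ 𝒮.κ K n)
    (K : ℕ) (τ : HIndex.Idx (skelFam T p₀)) : ((𝒮.reading T p₀).inputOf.run K τ).NewOK :=
  ⟨(𝒮.newOK_runPartial hν τ.1 τ.1 τ.2.2.1).ok⟩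

end Reading

section Envelope

variable (fB : ℕ → ℕ → ℕ → Lab d → ℝ) (fR : ℕ → ℕ → ℝ) (Λ : ℕ → ℕ → ℝ)

/-- **THE PER-STEP ENVELOPE, DEFINED**: the product of the level factors of the components of the level `j + 1`
the step forms, in the process run on the input read off the prefix `snoc g p`. [folklore] -/
def wStep (K j : ℕ) (g : Fin j → P) (p : P) : ℝ :=
  ∏ c ∈ (𝒮.runPartial K (j + 1) (Fin.snoc g p)).histM.comp (j + 1),
    lf fB fR Λ (𝒮.runPartial K (j + 1) (Fin.snoc g p)).histM (𝒮.runPartial K (j + 1) (Fin.snoc g p)).rnwM K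
      (j + 1) c

/-- the per-step envelope is non-negative for non-negative factor values [folklore] -/
theorem wStep_nonneg (hfB : ∀ K j d' n, 0 ≤ fB K j d' n) (hfR : ∀ K h, 0 ≤ fR K h) (hΛ : ∀ K j, 1 ≤ Λ K j)
    (K j : ℕ) (g : Fin j → P) (p : P) : 0 ≤ 𝒮.wStep fB fR Λ K j g p :=
  Finset.prod_nonneg fun c _ => lf_nonneg fB fR Λ hfB hfR hΛ _ _ K _ c

/-- **CAUSALITY AT THE TOWER: THE STEP-`j` ENVELOPE AFTER THE PREFIX `h|_j` WITH CHOICE `h j` IS THE LEVEL-`(j+1)`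
FACTOR PRODUCT OF THE RUN READ OFF THE WHOLE HISTORY** (J2a at `m := j + 1`: the two runs have the same flow
and classes, name the same regions at the levels `≤ j + 1` and the same new fields at the levels `≤ j`). [folklore] -/
theorem wStep_take (K : ℕ) (h : Fin K → P) (j : Fin K) :
    𝒮.wStep fB fR Λ K j (Fin.take j j.2.le h) (h j) =
      ∏ c ∈ (𝒮.runPartial K K h).histM.comp (j + 1),
        lf fB fR Λ (𝒮.runPartial K K h).histM (𝒮.runPartial K K h).rnwM K (j + 1) c := by
  have e : Fin.snoc (α := fun _ => P) (Fin.take j j.2.le h) (h j) = Fin.take (j + 1) j.2 h :=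
    (Fin.take_succ_eq_snoc j j.2 h).symm
  have hN : ∀ ℓ ≤ (j : ℕ) + 1, (𝒮.runPartial K (j + 1) (Fin.take (j + 1) j.2 h)).N ℓ = (𝒮.runPartial K K h).N ℓ :=
    fun ℓ hℓ => by
      cases ℓ with
      | zero => rfl
      | succ ℓ => exact 𝒮.Nof_take_succ j.2 h (Nat.lt_of_succ_le hℓ)
  have hF : ∀ ℓ < (j : ℕ) + 1,
      (𝒮.runPartial K (j + 1) (Fin.take (j + 1) j.2 h)).F ℓ = (𝒮.runPartial K K h).F ℓ :=
    fun ℓ hℓ => 𝒮.Fof_take j.2 h hℓ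
  unfold wStep
  rw [e, RunInputM.histM_comp_congr (I := 𝒮.runPartial K (j + 1) (Fin.take (j + 1) j.2 h))
    (I' := 𝒮.runPartial K K h) rfl rfl rfl hN hF]
  exact Finset.prod_congr rfl fun c _ =>
    lf_congr fB fR Λ (J := 𝒮.runPartial K (j + 1) (Fin.take (j + 1) j.2 h)) (J' := 𝒮.runPartial K K h)
      rfl rfl rfl rfl hN hF K c

/-- **p. 384 l. 4–6 AS AN IDENTITY: THE PRODUCT OF THE PER-STEP ENVELOPES ALONG A HISTORY IS THE LEVEL-BY-LEVEL
PRODUCT OF THE LEVEL FACTORS OF THE PROCESS READ OFF IT** (levels `1, …, K`; level `0` is empty). [folklore] -/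
theorem wAlong_wStep_eq (K : ℕ) (h : Fin K → P) :
    Tower.wAlong (𝒮.wStep fB fR Λ K) K h =
      ∏ j ∈ Finset.range K, ∏ c ∈ (𝒮.runPartial K K h).histM.comp (j + 1),
        lf fB fR Λ (𝒮.runPartial K K h).histM (𝒮.runPartial K K h).rnwM K (j + 1) c := by
  rw [wAlong_eq_prod, ← Fin.prod_univ_eq_prod_range]
  exact Finset.prod_congr rfl fun j _ => 𝒮.wStep_take fB fR Λ K h j

end Envelope

/-! ## §3 `HistRead` FOR THE TOWER WITH THE CAUSAL READING — from the per-step display alone -/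

section Read

variable [DecidableEq P] {C : ℕ → ℕ → Type} {𝒢 : (K j : ℕ) → GoodClass (C K j)}
  (T : (K : ℕ) → Tower P (C K) (𝒢 K)) (p₀ : ℕ → ℕ → P)
  (ρ₀ : (K : ℕ) → ℝ → C K 0 → ℝ) (hρ : ∀ K t, (𝒢 K 0).Gd (ρ₀ K t)) (h0 : ∀ K t x, 0 ≤ ρ₀ K t x)
  (B : ℕ → ℝ → ℝ) (hB : ∀ K t, 0 < B K t)
  (fB : ℕ → ℕ → ℕ → Lab d → ℝ) (fR : ℕ → ℕ → ℝ) (Λ : ℕ → ℕ → ℝ) (hΛ : ∀ K j, 1 ≤ Λ K j)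

/-- the level factor of J1's `factorsOf` IS `lf` of its values (definitionally) [folklore] -/
theorem levelFactor_factorsOf (w : (K : ℕ) → (j : ℕ) → (Fin j → P) → P → ℝ) (H : ComponentHistory (Lab d))
    (rnw : ℕ → Lab d → Bool) (K j : ℕ) (c : Lab d) :
    (factorsOf T p₀ B fB fR Λ hΛ w).levelFactor H rnw K j c = lf fB fR Λ H rnw K j c := rfl

/-- **`HistRead` FOR THE TOWER INSTANCE WITH THE CAUSAL READING**, from (i) U1 PER STEP IN LEVEL-FACTOR FORM `hw`
(the one display: the unit weight of the step-`j` operation after `g` with choice `p` is at most the level-factor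
product `wStep K j g p` of the level it forms — (1.79) p. 383 per operation, p. 384 l. 4–6), (ii) the sup of the
dressed initial density `hBρ`, (iii) the small-field choice names no region `hν0`, and non-negative factor
values.  NO per-history ∕ per-term display remains (J1's `hshift` holds with equality by `wStep_take`). [folklore] -/
theorem histRead_tower_of_hw {l₀ : ℝ} {K₀ : ℕ} (hfB : ∀ K j d' n, 0 ≤ fB K j d' n) (hfR : ∀ K h, 0 ≤ fR K h)
    (hw : ∀ K, K₀ ≤ K → ∀ j g p x, ((T K).op j g p).T (fun _ => 1) x ≤ 𝒮.wStep fB fR Λ K j g p)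
    (hBρ : ∀ K t, |t| ≤ l₀ → K₀ ≤ K → ∀ y, |ρ₀ K t y| ≤ B K t)
    (hν0 : ∀ K j g, 𝒮.ν K j g (p₀ K j) = ∅) :
    HistRead (𝒮.reading T p₀) (factorsOf T p₀ B fB fR Λ hΛ (𝒮.wStep fB fR Λ)) (reprFam T p₀ ρ₀ hρ h0 B hB)
      l₀ K₀ :=
  histRead_tower_shifted T p₀ ρ₀ hρ h0 B hB fB fR Λ hΛ (𝒮.wStep fB fR Λ) (𝒮.reading T p₀)
    (fun K j g p => 𝒮.wStep_nonneg fB fR Λ hfB hfR hΛ K j g p) hw hBρ (fun _ _ _ _ => rfl)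
    (fun K _ _ _ h _ j => (𝒮.wStep_take fB fR Λ K h j).le)
    (fun K _ => 𝒮.Nof_eq_empty fun j => hν0 K j _)

/-- **THE WEIGHT OF EVERY TOWER TERM IS BOUNDED BY THE EVENT PRODUCTS ALONG ITS PROCESS's PEDIGREE**, from the
per-step display `hw`, `hBρ`, `hν0`, the geometric condition `hν` on named regions and the flow condition `Rm ≤ R` —
M2-B's `weight_le_evProd` at `hR := histRead_tower_of_hw`, `hN := newOK_run`, by name. [folklore] -/
theorem weight_le_evProd_of_hw [∀ K, MeasurableSpace (C K K)] (μ : (K : ℕ) → Measure (C K K))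
    [∀ K, IsFiniteMeasure (μ K)] {l₀ : ℝ} {K₀ : ℕ} (hfB : ∀ K j d' n, 0 ≤ fB K j d' n) (hfR : ∀ K h, 0 ≤ fR K h)
    (hw : ∀ K, K₀ ≤ K → ∀ j g p x, ((T K).op j g p).T (fun _ => 1) x ≤ 𝒮.wStep fB fR Λ K j g p)
    (hBρ : ∀ K t, |t| ≤ l₀ → K₀ ≤ K → ∀ y, |ρ₀ K t y| ≤ B K t)
    (hν0 : ∀ K j g, 𝒮.ν K j g (p₀ K j) = ∅)
    (hν : ∀ K j g p, ∀ n ∈ 𝒮.ν K j g p, n.1 ∈ n.2 ∧ FaceConnected n.2 ∧ treeLen n.2 ≤ 𝒮.κ K n)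
    (hRm : ∀ K s k, 𝒮.Rm K s k ≤ 𝒮.R K s)
    {K : ℕ} (hK : K₀ ≤ K) {t : ℝ} (ht : |t| ≤ l₀) {τ : HIndex.Idx (skelFam T p₀)}
    (hτ : τ ∈ HIndex.termSet (skelFam T p₀) K) :
    Repr172R.weight μ (reprFam T p₀ ρ₀ hρ h0 B hB) t τ ≤
      (∏ j ∈ Finset.range (K + 1), ∏ c ∈ ((𝒮.reading T p₀).inputOf.run K τ).histM.comp j,
          (factorsOf T p₀ B fB fR Λ hΛ (𝒮.wStep fB fR Λ)).Λ K j ^ (c.2).card) *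
        ((∏ c ∈ (𝒮.reading T p₀).inputOf.liveC K τ,
            evProd ((factorsOf T p₀ B fB fR Λ hΛ (𝒮.wStep fB fR Λ)).fB K)
              ((factorsOf T p₀ B fB fR Λ hΛ (𝒮.wStep fB fR Λ)).fR K)
              (((𝒮.reading T p₀).inputOf.ped K τ).toPGen id c)) *
          ∏ j ∈ Finset.range K, ∏ c ∈ ((𝒮.reading T p₀).inputOf.run K τ).histM.died j,
            evProd ((factorsOf T p₀ B fB fR Λ hΛ (𝒮.wStep fB fR Λ)).fB K)
              ((factorsOf T p₀ B fB fR Λ hΛ (𝒮.wStep fB fR Λ)).fR K)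
              (((𝒮.reading T p₀).inputOf.ped K τ).toPGen id (j, c))) *
        (factorsOf T p₀ B fB fR Λ hΛ (𝒮.wStep fB fR Λ)).rest (fun K => (μ K).real Set.univ) t τ :=
  weight_le_evProd (𝒮.reading T p₀) _ μ _
    (𝒮.histRead_tower_of_hw T p₀ ρ₀ hρ h0 B hB fB fR Λ hΛ hfB hfR hw hBρ hν0)
    (fun K _ τ _ => 𝒮.newOK_run T p₀ hν K τ) (fun K _ _ _ s k => hRm K s k) hK ht hτ

end Read

end StepReading

end

end Summit.QuantumFields.BalabanUV.T4Continuum.B16HistoryReprReadCausal
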